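import Summits.ValiantsHypothesis.ValiantsHypothesis.Theorems.SymPencilSdcPerThreeThirteen

/-!
# Route `SymPencil` — the bordered Schur design with a unipotent twist
# (`--supports` stmt-ValiantsHypothesis-5674 `SdcSuperquadratic`; engine for the `m = 25 … 28` designs)

`SymPencilSdcPerThreeThirteen.det_bordered_fromBlocks` computes the determinant of the bordered Schur
design with off-diagonal block `1`:
`det [[0, (v,0)ᵀ], [(v,0), [[0, 1], [1, S]]]] = (−1)^{|ι|} · vᵀ S v`.  The general origin normal form of a
symmetric representation in the one-row Lagrangian cell `(r, dim V, d) = (12, 4, 0)` of `per₄` at `m = 25`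
(crux notes `Cruxes/SdcPerBeyondN/NEXT-RUNG-H*.md`) has an arbitrary off-diagonal block
`X = 1 + C₁₂(z)` ("twist") and a diagonal block `C₁₁`; with `C₁₁ = 0` the determinant is governed by
the TWISTED identity proved here, for any square `X` invertible over the coefficient ring (e.g.
`X = 1 + K` with `K` nilpotent, where `⅟X` is a polynomial in `K`):

* `fromBlocks_zero_twist_mul`: `[[0, X], [Xᵀ, S]] · [[−X⁻ᵀ S X⁻¹, X⁻ᵀ], [X⁻¹, 0]] = 1`;
* `det_fromBlocks_zero_twist`: `det [[0, X], [Xᵀ, S]] = (−1)^{|ι|} · (det X)²`;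
* `det_bordered_fromBlocks_twist`:
  `det [[0, (v,0)ᵀ], [(v,0), [[0, X], [Xᵀ, S]]]] = (−1)^{|ι|} · (det X)² · (X⁻¹v)ᵀ S (X⁻¹v)`,
  i.e. `(−1)^{|ι|} · uᵀ S u` with `u = adj(X) v` when `det X = 1`.

This is the identity behind the "pure-ansatz no-go" of NEXT-RUNG-H5 (H5.3): with `X = 1 + K(v)` nilpotent
in `v` and `S = S(r)` Koszul, the substitution `r = X r̃` makes the right-hand side `v`-linear.  Pure
linear algebra over any commutative ring; nothing here bears on `VP ≠ VNP`.
-/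

noncomputable section

-- single-conjunct layout: Sub = Summit, duplicated namespace component intended
set_option linter.dupNamespace false

namespace Summit.ValiantsHypothesis.ValiantsHypothesis.Theorems.SymPencilBorderedSchurTwist

open Matrix
open Summit.ValiantsHypothesis.ValiantsHypothesis.Theorems.SymPencilSdcPerThreeThirteen

variable {ι P : Type*} [Fintype ι] [DecidableEq ι] [CommRing P]

/-- The twisted lower block `[[0, X], [Xᵀ, S]]` has the explicit inverse
`[[−X⁻ᵀ S X⁻¹, X⁻ᵀ], [X⁻¹, 0]]` whenever `X` is invertible. [folklore] -/
theorem fromBlocks_zero_twist_mul (X S : Matrix ι ι P) [Invertible X] :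
    Matrix.fromBlocks (0 : Matrix ι ι P) X Xᵀ S *
        Matrix.fromBlocks (-((⅟X)ᵀ * S * ⅟X)) (⅟X)ᵀ (⅟X) 0 = 1 := by
  have hX : X * ⅟X = 1 := mul_invOf_self X
  have hXt : Xᵀ * (⅟X)ᵀ = 1 := by rw [← Matrix.transpose_mul, invOf_mul_self, Matrix.transpose_one]
  have h21 : Xᵀ * -((⅟X)ᵀ * S * ⅟X) + S * ⅟X = 0 := by
    rw [Matrix.mul_neg, ← Matrix.mul_assoc, ← Matrix.mul_assoc, hXt, Matrix.one_mul, neg_add_cancel]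
  rw [Matrix.fromBlocks_multiply, h21]
  simp only [Matrix.zero_mul, zero_add, Matrix.mul_zero, add_zero, hX, hXt, Matrix.fromBlocks_one]

/-- `det [[0, X], [Xᵀ, S]] = (−1)^{|ι|} (det X)²`: congruence
`[[1, 0], [0, Xᵀ]] · [[0, 1], [1, X⁻ᵀ S X⁻¹]] · [[1, 0], [0, X]]` with
`SymPencilSdcPerThreeThirteen.det_fromBlocks_zero_one_one`. [folklore] -/
theorem det_fromBlocks_zero_twist (X S : Matrix ι ι P) [Invertible X] :
    (Matrix.fromBlocks (0 : Matrix ι ι P) X Xᵀ S).det = (-1) ^ Fintype.card ι * X.det ^ 2 := by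
  have hfac : Matrix.fromBlocks (0 : Matrix ι ι P) X Xᵀ S =
      Matrix.fromBlocks (1 : Matrix ι ι P) 0 0 Xᵀ *
        Matrix.fromBlocks (0 : Matrix ι ι P) 1 1 ((⅟X)ᵀ * S * ⅟X) *
        Matrix.fromBlocks (1 : Matrix ι ι P) 0 0 X := by
    have hXt : Xᵀ * (⅟X)ᵀ = 1 := by
      rw [← Matrix.transpose_mul, invOf_mul_self, Matrix.transpose_one]
    rw [Matrix.fromBlocks_multiply, Matrix.fromBlocks_multiply]
    simp only [Matrix.zero_mul, Matrix.mul_zero, zero_add, add_zero, Matrix.one_mul, Matrix.mul_one]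
    congr 1
    rw [← Matrix.mul_assoc, ← Matrix.mul_assoc, hXt, Matrix.one_mul, Matrix.mul_assoc,
      invOf_mul_self, Matrix.mul_one]
  rw [hfac, Matrix.det_mul, Matrix.det_mul, Matrix.det_fromBlocks_zero₂₁, Matrix.det_fromBlocks_zero₂₁,
    det_fromBlocks_zero_one_one, Matrix.det_one, one_mul, one_mul, Matrix.det_transpose]
  ring

/-- **Twisted bordered Schur determinant.**  For `X` invertible and any `S`,
`det [[0, (v,0)ᵀ], [(v,0), [[0, X], [Xᵀ, S]]]] = (−1)^{|ι|} (det X)² · (X⁻¹v)ᵀ S (X⁻¹v)`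
(`= (−1)^{|ι|} uᵀ S u` with `u = adj(X) v` when `det X = 1`). [folklore] -/
theorem det_bordered_fromBlocks_twist (v : ι → P) (X S : Matrix ι ι P) [Invertible X] :
    (Matrix.fromBlocks (0 : Matrix Unit Unit P) (replicateRow Unit (Sum.elim v 0))
        (replicateCol Unit (Sum.elim v 0)) (Matrix.fromBlocks (0 : Matrix ι ι P) X Xᵀ S)).det =
      (-1) ^ Fintype.card ι * X.det ^ 2 *
        ∑ i, ∑ j, (⅟X *ᵥ v) i * S i j * (⅟X *ᵥ v) j := by
  letI : Invertible (Matrix.fromBlocks (0 : Matrix ι ι P) X Xᵀ S) :=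
    invertibleOfRightInverse _ _ (fromBlocks_zero_twist_mul X S)
  have hinv : ⅟(Matrix.fromBlocks (0 : Matrix ι ι P) X Xᵀ S) =
      Matrix.fromBlocks (-((⅟X)ᵀ * S * ⅟X)) (⅟X)ᵀ (⅟X) 0 :=
    invOf_eq_right_inv (fromBlocks_zero_twist_mul X S)
  have h1 : ∀ N : Matrix Unit Unit P, N.det = N () () := fun N => by
    rw [Matrix.det_unique]
  rw [Matrix.det_fromBlocks₂₂, det_fromBlocks_zero_twist, hinv, h1, Matrix.sub_apply,
    Matrix.zero_apply, zero_sub, replicateRow_mul_mul_replicateCol]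
  have hsum : (∑ i : ι ⊕ ι, ∑ j : ι ⊕ ι, Sum.elim v 0 i *
        Matrix.fromBlocks (-((⅟X)ᵀ * S * ⅟X)) (⅟X)ᵀ (⅟X) 0 i j * Sum.elim v 0 j) =
      -(v ⬝ᵥ (((⅟X)ᵀ * S * ⅟X) *ᵥ v)) := by
    simp only [Fintype.sum_sum_type, Sum.elim_inl, Sum.elim_inr, Matrix.fromBlocks_apply₁₁,
      Matrix.fromBlocks_apply₂₁, Matrix.neg_apply, Pi.zero_apply, mul_zero, zero_mul, add_zero,
      Finset.sum_const_zero, mul_neg, neg_mul, Finset.sum_neg_distrib, dotProduct, mulVec,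
      Finset.mul_sum, mul_assoc]
  have key : v ⬝ᵥ (((⅟X)ᵀ * S * ⅟X) *ᵥ v) = ∑ a, ∑ b, (⅟X *ᵥ v) a * S a b * (⅟X *ᵥ v) b := by
    rw [← Matrix.mulVec_mulVec, ← Matrix.mulVec_mulVec, Matrix.dotProduct_mulVec,
      Matrix.vecMul_transpose]
    simp only [dotProduct, mulVec, Finset.mul_sum, mul_assoc]
  rw [hsum, neg_neg, key]

end Summit.ValiantsHypothesis.ValiantsHypothesis.Theorems.SymPencilBorderedSchurTwist

end
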